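import Summits.RiemannHypothesis.RiemannHypothesis.Theorems.PfPersistenceGapClassG1
import HarnessLib

/-!
# PF persistence — ENTRY TUBES: the open stratum reduces to a radius profile (pub-rhpf, barrier-typer gen 9)

**HONEST FRAMING. This is a long-odds MECHANISM SEARCH; no RH claims.** Labels PROVED / TYPED as in
`PfPersistenceAdmissibleClass.lean`; everything here is RH-free bookkeeping about the SHAPE of criteria in the
cell's one open gap class G1 (`InG1cont`, `InG1contU` of `PfPersistenceGapClassG1`). Nothing bears on the truth of
RH: both sides of every equivalence below are OPEN statements.

The human directive for this seat — "find the invariant or prove conclusively that it can't be found (i.e. RH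
strength)" — asks where, inside G1, a separating criterion could live. This file answers the EXISTENCE half with a
reduction (the companion thin-tube TRACE file `PfPersistenceThinTubeTrace` closes it on the arithmetic domains):

* §1 ENTRY TUBES `entryTube r d₀ = {d | ∀ win i j, |d win i j − d₀ win i j| < r win}` for a RADIUS PROFILE
  `r : Window → ℝ`: window-wise OPEN, NON-LOCAL at every height, hence members of `G1-cont` containing `d₀`
  (PROVED `inG1cont_entryTube`; two-sided analogue of cand-6's one-sided coupling tube, `PfPersistenceLoewnerAntichain`).
* §2 THE TUBE REDUCTION (PROVED `IsWindowwiseOpen.exists_entryTube_subset`, `Separates.of_subset`,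
  `exists_windowwiseOpen_separates_iff`, `exists_inG1cont_separates_iff`): a window-wise open criterion containing
  `d₀` contains an entry tube about `d₀` (the window-wise open sets are the BOX-open sets of `∏_win Matrix`), and
  separation descends to sub-criteria containing `d₀`. Hence for EVERY domain `D`:
  `(∃ S, InG1cont S ∧ Separates S D ζ) ↔ (∃ S, IsWindowwiseOpen S ∧ Separates S D ζ) ↔ ∃ r > 0, Separates (entryTube r ζ) D ζ`
  — an open-stratum "invariant" IS a radius profile `r` such that every negative of `D` leaves the `r`-tube about `ζ`
  at some window and entry (`separates_entryTube_iff`); clauses (2) (3) of G1 and every reader vocabulary (bottom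
  vectors, one-signedness, ladders, transport) are decoration as far as EXISTENCE goes. For the class of record
  `InG1contU` only `→` holds (`boxIsolated_of_exists_inG1contU_separates`).
* §3 THE EXISTENCE SANDWICH (PROVED `boxIsolated_of_mem_strictPositiveClass`, `allWindowsPositive_of_boxIsolated`,
  `existence_sandwich`): for every domain `D ∋ ζ`,
  `ζ ∈ P⁺ (strict Galerkin positivity) ⟹ (∃ S, InG1cont S ∧ Separates S D ζ) ⟹ AllWindowsPositive ζ`.
  So the existence of a G1-cont invariant is pinned between strict and plain Galerkin Weil positivity of `ζ`
  whatever the control family: "finding it" proves the latter, "proving it cannot be found" refutes the former —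
  BOTH are RH-strength statements (HONEST LABEL: neither is decided here).
-/

set_option linter.dupNamespace false  -- the mandated namespace repeats `RiemannHypothesis`

noncomputable section

open Real Finset Matrix Filter Topology

namespace Summit.RiemannHypothesis.RiemannHypothesis.Theorems.PfPersistence

/-! ## §1 Entry tubes: window-wise open, non-local at every height, in G1-cont -/

/-- The ENTRY TUBE of radius profile `r` about `d₀`: entrywise `r win`-close to `d₀` at EVERY window (the basic
BOX-open neighbourhoods of `d₀` in `∏_win Matrix`). [folklore] -/
def entryTube (r : Window → ℝ) (d₀ : Datum) : Set Datum :=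
  {d | ∀ win : Window, ∀ i j : Fin (win.N + 1), |d win i j - d₀ win i j| < r win}

/-- PROVED: the centre lies in its tube (positive profile). [folklore] -/
theorem mem_entryTube_self {r : Window → ℝ} (hr : ∀ win, 0 < r win) (d₀ : Datum) : d₀ ∈ entryTube r d₀ :=
  fun win i j => by simpa using hr win

/-- PROVED: tubes are monotone in the profile. [folklore] -/
theorem entryTube_mono {r r' : Window → ℝ} (h : ∀ win, r win ≤ r' win) (d₀ : Datum) :
    entryTube r d₀ ⊆ entryTube r' d₀ :=
  fun _ hd win i j => (hd win i j).trans_le (h win)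

/-- PROVED: an entrywise ball is OPEN in the matrix topology (finite intersection of open slabs). [folklore] -/
theorem isOpen_entryBall {k : ℕ} (M₀ : Matrix (Fin k) (Fin k) ℝ) (ρ : ℝ) :
    IsOpen {M : Matrix (Fin k) (Fin k) ℝ | ∀ i j, |M i j - M₀ i j| < ρ} := by
  simp only [Set.setOf_forall]
  refine isOpen_iInter_of_finite fun i => isOpen_iInter_of_finite fun j => ?_
  exact isOpen_lt ((continuous_id.matrix_elem i j).sub continuous_const).abs continuous_const

/-- PROVED: entry tubes are WINDOW-WISE OPEN (clause (1) of G1). [folklore] -/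
theorem isWindowwiseOpen_entryTube (r : Window → ℝ) (d₀ : Datum) : IsWindowwiseOpen (entryTube r d₀) :=
  ⟨fun win => {M | ∀ i j, |M i j - d₀ win i j| < r win}, fun win => isOpen_entryBall (d₀ win) (r win), rfl⟩

/-- PROVED: entry tubes are NON-LOCAL AT EVERY HEIGHT (clause (2); exit: push the `(0,0)` entry of the centre at the
window above `A` out by `r`). [folklore] -/
theorem nonlocalAtEveryHeight_entryTube {r : Window → ℝ} (hr : ∀ win, 0 < r win) (d₀ : Datum) :
    NonlocalAtEveryHeight (entryTube r d₀) := by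
  classical
  intro A
  refine not_determinedOn_of_exit (mem_entryTube_self hr d₀) ?_ (windowAbove_not_mem_below A)
    (d := Function.update d₀ (windowAbove A) (d₀ (windowAbove A) +
      r (windowAbove A) • (1 : Matrix (Fin ((windowAbove A).N + 1)) (Fin ((windowAbove A).N + 1)) ℝ)))
    fun win hwin => by simp [hwin]
  intro hd
  have h := hd (windowAbove A) 0 0
  simp [Matrix.one_apply_eq] at h
  rw [abs_of_pos (hr _)] at h
  exact lt_irrefl _ h

/-- **PROVED — MEMBERSHIP CERTIFICATE: every entry tube with positive profile lies in `G1-cont`.** [folklore] -/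
theorem inG1cont_entryTube {r : Window → ℝ} (hr : ∀ win, 0 < r win) (d₀ : Datum) : InG1cont (entryTube r d₀) :=
  inG1cont_of (isWindowwiseOpen_entryTube r d₀) (nonlocalAtEveryHeight_entryTube hr d₀)

/-! ## §2 The tube reduction -/

/-- **PROVED — BOX BASIS:** a window-wise open criterion contains an entry tube (positive profile) about each of its
members: per window the open set `U win ∋ d₀ win` contains a sup-metric ball. [folklore] -/
theorem IsWindowwiseOpen.exists_entryTube_subset {S : Set Datum} (hS : IsWindowwiseOpen S) {d₀ : Datum}
    (h₀ : d₀ ∈ S) : ∃ r : Window → ℝ, (∀ win, 0 < r win) ∧ entryTube r d₀ ⊆ S := by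
  obtain ⟨U, hU, rfl⟩ := hS
  have h₀U : ∀ win, d₀ win ∈ U win := h₀
  have key : ∀ win : Window, ∃ ε : ℝ, 0 < ε ∧ ∀ M : Matrix (Fin (win.N + 1)) (Fin (win.N + 1)) ℝ,
      (∀ i j, |M i j - d₀ win i j| < ε) → M ∈ U win := by
    intro win
    have hUo : IsOpen (show Set (Fin (win.N + 1) → Fin (win.N + 1) → ℝ) from U win) := hU win
    obtain ⟨ε, hε, hball⟩ := Metric.isOpen_iff.1 hUo (d₀ win) (h₀U win)
    refine ⟨ε, hε, fun M hM => hball ?_⟩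
    rw [Metric.mem_ball, dist_pi_lt_iff hε]
    intro i
    rw [dist_pi_lt_iff hε]
    intro j
    rw [Real.dist_eq]
    exact hM i j
  choose r hr hrU using key
  exact ⟨r, hr, fun d hd win => hrU win (d win) (hd win)⟩

/-- PROVED: separation DESCENDS to sub-criteria containing the centre (soundness is inherited, membership of the
centre is the hypothesis). Compare `Separates.anti` (antitone in the DOMAIN). [folklore] -/
theorem Separates.of_subset {S S' D : Set Datum} {d₀ : Datum} (h : Separates S D d₀) (hS' : S' ⊆ S)
    (hd₀ : d₀ ∈ S') : Separates S' D d₀ :=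
  ⟨hd₀, fun d hdD hneg hdS' => h.2 d hdD hneg (hS' hdS')⟩

/-- PROVED (unfolding): a tube separates iff every negative of the domain LEAVES it at some window and entry. [folklore] -/
theorem separates_entryTube_iff {r : Window → ℝ} (hr : ∀ win, 0 < r win) (D : Set Datum) (d₀ : Datum) :
    Separates (entryTube r d₀) D d₀ ↔
      ∀ d ∈ D, DetectablyNegative d → ∃ win : Window, ∃ i j : Fin (win.N + 1), r win ≤ |d win i j - d₀ win i j| := by
  simp only [Separates, entryTube, Set.mem_setOf_eq, not_forall, not_lt]
  exact ⟨fun h => h.2, fun h => ⟨fun win i j => by simpa using hr win, h⟩⟩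

/-- BOX ISOLATION of `d₀` from the negatives of `D`: some positive radius profile whose tube about `d₀` no negative
of `D` enters — the profile IS the "invariant" of the open stratum (§2 reduction). TYPED carve. [folklore] -/
def BoxIsolated (D : Set Datum) (d₀ : Datum) : Prop :=
  ∃ r : Window → ℝ, (∀ win, 0 < r win) ∧ Separates (entryTube r d₀) D d₀

/-- **PROVED — THE TUBE REDUCTION (window-wise open stratum):** an open separator exists iff a tube separator
exists. [folklore] -/
theorem exists_windowwiseOpen_separates_iff (D : Set Datum) (d₀ : Datum) :
    (∃ S, IsWindowwiseOpen S ∧ Separates S D d₀) ↔ BoxIsolated D d₀ := by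
  constructor
  · rintro ⟨S, hS, hsep⟩
    obtain ⟨r, hr, hsub⟩ := hS.exists_entryTube_subset hsep.1
    exact ⟨r, hr, hsep.of_subset hsub (mem_entryTube_self hr d₀)⟩
  · rintro ⟨r, hr, hsep⟩
    exact ⟨_, isWindowwiseOpen_entryTube r d₀, hsep⟩

/-- **PROVED — THE TUBE REDUCTION (G1-cont):** clauses (2) (3) of G1 add nothing to EXISTENCE — a G1-cont separator
exists iff a tube separator exists (the tube itself is G1-cont). [folklore] -/
theorem exists_inG1cont_separates_iff (D : Set Datum) (d₀ : Datum) :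
    (∃ S, InG1cont S ∧ Separates S D d₀) ↔ BoxIsolated D d₀ :=
  ⟨fun ⟨S, hS, hsep⟩ => (exists_windowwiseOpen_separates_iff D d₀).1 ⟨S, hS.1, hsep⟩,
    fun ⟨_, hr, hsep⟩ => ⟨_, inG1cont_entryTube hr d₀, hsep⟩⟩

/-- PROVED: for the class of record `InG1contU` the reduction holds in the `→` direction (a floor on bounded heights
is what the converse would need, cf. cand-6's `inG1contU_tube`). [folklore] -/
theorem boxIsolated_of_exists_inG1contU_separates {D : Set Datum} {d₀ : Datum}
    (h : ∃ S, InG1contU S ∧ Separates S D d₀) : BoxIsolated D d₀ :=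
  let ⟨S, hS, hsep⟩ := h; (exists_inG1cont_separates_iff D d₀).1 ⟨S, hS.1, hsep⟩

/-! ## §3 The existence sandwich -/

/-- PROVED: a separator on a domain containing the centre forces the centre to be all-window positive (T0's `→`,
for ANY criterion). [folklore] -/
theorem Separates.allWindowsPositive {S D : Set Datum} {d₀ : Datum} (h : Separates S D d₀) (hd₀ : d₀ ∈ D) :
    AllWindowsPositive d₀ := by
  by_contra hneg
  exact h.2 d₀ hd₀ ((detectablyNegative_iff_not_allWindowsPositive d₀).2 hneg) h.1

/-- PROVED: box isolation on a domain containing the centre forces all-window positivity of the centre. [folklore] -/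
theorem allWindowsPositive_of_boxIsolated {D : Set Datum} {d₀ : Datum} (h : BoxIsolated D d₀) (hd₀ : d₀ ∈ D) :
    AllWindowsPositive d₀ :=
  let ⟨_, _, hsep⟩ := h; hsep.allWindowsPositive hd₀

/-- PROVED: `P⁺` separates each of its members from the negatives of ANY domain (`P⁺ ⊆ 𝒫`). [folklore] -/
theorem separates_strictPositiveClass {d₀ : Datum} (h : d₀ ∈ strictPositiveClass) (D : Set Datum) :
    Separates strictPositiveClass D d₀ :=
  ⟨h, fun d _ hneg hd =>
    (detectablyNegative_iff_not_allWindowsPositive d).1 hneg (strictPositiveClass_subset_positiveClass hd)⟩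

/-- **PROVED — UPPER END OF THE SANDWICH:** a STRICTLY positive centre is box-isolated from the negatives of every
domain (`P⁺` is window-wise open and misses all negatives; take the tube it contains). [folklore] -/
theorem boxIsolated_of_mem_strictPositiveClass {d₀ : Datum} (h : d₀ ∈ strictPositiveClass) (D : Set Datum) :
    BoxIsolated D d₀ :=
  (exists_windowwiseOpen_separates_iff D d₀).1
    ⟨strictPositiveClass, isWindowwiseOpen_strictPositiveClass, separates_strictPositiveClass h D⟩

/-- **PROVED — THE EXISTENCE SANDWICH for `ζ` on any domain `D ∋ ζ`:**
`ζ ∈ P⁺ ⟹ (∃ S, InG1cont S ∧ Separates S D ζ) ⟹ AllWindowsPositive ζ`. HONEST LABEL: both ends are open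
(strict / plain Galerkin Weil positivity of `ζ`); the existence of a G1-cont invariant is an RH-strength statement
from both sides, for every control family containing `ζ`. [folklore] -/
theorem existence_sandwich (D : Set Datum) (hζ : zetaDatum ∈ D) :
    (zetaDatum ∈ strictPositiveClass → ∃ S, InG1cont S ∧ Separates S D zetaDatum) ∧
      ((∃ S, InG1cont S ∧ Separates S D zetaDatum) → AllWindowsPositive zetaDatum) :=
  ⟨fun h => (exists_inG1cont_separates_iff D zetaDatum).2 (boxIsolated_of_mem_strictPositiveClass h D),
    fun h => allWindowsPositive_of_boxIsolated ((exists_inG1cont_separates_iff D zetaDatum).1 h) hζ⟩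

end Summit.RiemannHypothesis.RiemannHypothesis.Theorems.PfPersistence
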